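import Summits.QuantumFields.YangMills.Theorems.AllWindowsColdBoxBoxKernelGreen

/-!
# Estimate (T): `(1 + dist_∞)⁻⁴` decay of the mixed second differences of the Dirichlet/Neumann box Green function in `d = 4`
# (STUB-PLAN-K1-24006 §3, route (T2), for LINE-18 stub K1 `DirKernelDipoleDecay`, crux `AllWindowsColdBox.BulkMidWindowSU2`,
# stmt-QuantumFields-24006 — part 3)

* `repr_bound` — for `0 ≤ s, s' < M`, `δ ∈ {0,1}`, `m ∈ {s − s', s + s', s + s' + 1}` every representative of `m + δ (mod 2M)` has
  absolute value `≥ |s − s'| − 1` (the images are no closer than the direct point, up to the unit shift of a difference);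
* `boxGreen_hessian_eq` — `Δ_a Δ'_b G_B(y,y') = ½ Σ_σ sgn(σ)·(±H_{ab}(ι y − σ·ι y' [+ e_b]))` with the torus Hessian
  `H_{ab}(z) = G̃(z+e_a) − G̃(z+e_a−e_b) − G̃(z) + G̃(z−e_b)`;
* **`boxGreen_hessian_decay`** — an absolute `C` with `|Δ_a Δ'_b G_B(s,s')|·(1 + |s_κ − s'_κ|)⁴ ≤ C` for ALL half-periods `M ≥ 1`, all
  Dirichlet sets, directions `a, b, κ` and box points `s, s'` (sixteen images × the all-points torus bound `torusGreen_hessian_le`,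
  each image at torus distance `≥ |s_κ − s'_κ| − 1` in the coordinate `κ`); **`boxLap_inv_hessian_decay`** — the same for the entries of
  `boxLap⁻¹` (nonempty `Dset`), i.e. `|∇_a∇'_b L⁻¹(z,z')| ≤ C (1 + |z − z'|_∞)^{−4}` uniformly in the box: the estimate (T) that, with
  Jaffard's theorem (`…AllWindowsColdBoxJaffardDecay`) and the linear algebra K1-B/C/D, yields K1.
Standard axioms; constants quantified before the box.

HONEST LABEL: helper toward one registered stub (K1, OPEN: K1-B/C/D/E/F remain) of a critic-passed line on the R2ξ″ RECORD-rung crux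
24006; no stub, crux, rung or summit is proved here; the Yang–Mills mass gap is NOT proved by this file.
-/

set_option autoImplicit false

noncomputable section

open Finset ZMod
open scoped Real BigOperators

namespace Summit.QuantumFields.YangMills.Theorems.AllWindowsColdBox.BoxKernel

open Literature.Probability.LatticeModels

variable {d : ℕ}

/-! ## Representatives of the image coordinates -/

/-- For `0 ≤ s, s' < M`, `|δ| ≤ 1` and `m ∈ {s − s', s + s', s + s' + 1}` (the coordinate of a point minus the coordinate of an
image), every representative of `m + δ` modulo `2M` has absolute value `≥ |s − s'| − 1`. -/
theorem repr_bound {M : ℕ} {s s' δ m : ℤ} (hs0 : 0 ≤ s) (hsM : s < M) (hs0' : 0 ≤ s') (hsM' : s' < M)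
    (hδ0 : -1 ≤ δ) (hδ1 : δ ≤ 1) (hm : m = s - s' ∨ m = s + s' ∨ m = s + s' + 1) (j : ℤ) :
    |s - s'| - 1 ≤ |m + δ - (2 * M : ℕ) * j| := by
  push_cast
  set P : ℤ := 2 * (M : ℤ) * j with hP
  have hcase : P ≤ -(2 * M) ∨ P = 0 ∨ P = 2 * M ∨ 4 * M ≤ P := by
    rcases lt_trichotomy j 0 with hj | rfl | hj
    · left; rw [hP]; nlinarith
    · right; left; rw [hP]; ring
    · rcases eq_or_lt_of_le (show (1 : ℤ) ≤ j from hj) with rfl | hj2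
      · right; right; left; rw [hP]; ring
      · right; right; right; rw [hP]; nlinarith
  rw [le_abs]
  rcases abs_cases (s - s') with ⟨habs, _⟩ | ⟨habs, _⟩ <;> rw [habs] <;>
    rcases hm with rfl | rfl | rfl <;> rcases hcase with h | h | h | h <;> omega

/-! ## The second differences of the image sum -/

variable {M : ℕ} [NeZero M] {Dset : Finset (Fin d)}

omit [NeZero M] in
/-- Shifting the source shifts its image by `±e_b`. -/
theorem refl_add_single (σ : Fin d → Bool) (c : TorusSite d (2 * M)) (b : Fin d) :
    refl M Dset σ (c + Pi.single b 1) = refl M Dset σ c + (if σ b then -Pi.single b 1 else Pi.single b 1) := by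
  funext κ
  by_cases hκ : κ = b
  · subst hκ
    simp only [refl, Pi.add_apply, Pi.single_eq_same]
    by_cases hσ : σ κ = true
    · simp only [hσ, if_true, Pi.neg_apply, Pi.single_eq_same]
      split_ifs <;> ring
    · simp only [hσ, Bool.false_eq_true, if_false, Pi.single_eq_same]
  · simp only [refl, Pi.add_apply, Pi.single_eq_of_ne hκ, add_zero]
    split_ifs <;> simp [Pi.single_eq_of_ne hκ]

/-- `|sgn σ| = 1`. -/
theorem abs_sgn (Dset : Finset (Fin d)) (σ : Fin d → Bool) : |sgn Dset σ| = 1 := by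
  unfold sgn
  rw [Finset.abs_prod]
  exact Finset.prod_eq_one fun ν _ => by split_ifs <;> simp

/-- **The mixed second difference of the box Green function as a signed sum of torus Hessians**: with `w = ι s`, `c' = ι s'`,
`u_σ = w − σ·c'`,  `Δ_a Δ'_b G_B(s, s') = ½ Σ_σ sgn(σ)·(±H_{ab}(u_σ [+ e_b]))`, where `H_{ab}(z) = G̃(z+e_a) − G̃(z+e_a−e_b) − G̃(z) + G̃(z−e_b)`:
the term is `−H_{ab}(u_σ)` if `σ` does not flip `b` and `+H_{ab}(u_σ + e_b)` if it does. -/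
theorem boxGreen_hessian_eq (y y' : Fin d → ℤ) (a b : Fin d) :
    boxGreen M Dset (y + Pi.single a 1) (y' + Pi.single b 1) - boxGreen M Dset (y + Pi.single a 1) y' -
        boxGreen M Dset y (y' + Pi.single b 1) + boxGreen M Dset y y' =
      (1 / 2 : ℝ) * ∑ σ : Fin d → Bool, sgn Dset σ *
        (if σ b then
          (torusGreen (toTorus M y - refl M Dset σ (toTorus M y') + Pi.single b 1 + Pi.single a 1) -
            torusGreen (toTorus M y - refl M Dset σ (toTorus M y') + Pi.single b 1 + Pi.single a 1 - Pi.single b 1) -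
            torusGreen (toTorus M y - refl M Dset σ (toTorus M y') + Pi.single b 1) +
            torusGreen (toTorus M y - refl M Dset σ (toTorus M y') + Pi.single b 1 - Pi.single b 1))
        else
          -(torusGreen (toTorus M y - refl M Dset σ (toTorus M y') + Pi.single a 1) -
            torusGreen (toTorus M y - refl M Dset σ (toTorus M y') + Pi.single a 1 - Pi.single b 1) -
            torusGreen (toTorus M y - refl M Dset σ (toTorus M y')) +
            torusGreen (toTorus M y - refl M Dset σ (toTorus M y') - Pi.single b 1))) := by
  unfold boxGreen imageSum
  rw [toTorus_add_single, toTorus_add_single]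
  rw [Finset.mul_sum, Finset.mul_sum, Finset.mul_sum, Finset.mul_sum, Finset.mul_sum, ← Finset.sum_sub_distrib,
    ← Finset.sum_sub_distrib, ← Finset.sum_add_distrib]
  refine Finset.sum_congr rfl fun σ _ => ?_
  rw [refl_add_single]
  set u : TorusSite d (2 * M) := toTorus M y - refl M Dset σ (toTorus M y') with hu
  by_cases hσ : σ b = true
  · simp only [hσ, if_true]
    have e1 : toTorus M y + Pi.single a 1 - (refl M Dset σ (toTorus M y') + -Pi.single b 1) = u + Pi.single b 1 + Pi.single a 1 := by
      rw [hu]; abel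
    have e2 : toTorus M y + Pi.single a 1 - refl M Dset σ (toTorus M y') = u + Pi.single b 1 + Pi.single a 1 - Pi.single b 1 := by
      rw [hu]; abel
    have e3 : toTorus M y - (refl M Dset σ (toTorus M y') + -Pi.single b 1) = u + Pi.single b 1 := by rw [hu]; abel
    have e4 : u = u + Pi.single b 1 - Pi.single b 1 := by abel
    rw [e1, e2, e3]
    nth_rewrite 4 [e4]
    ring
  · simp only [hσ, Bool.false_eq_true, if_false]
    have e1 : toTorus M y + Pi.single a 1 - (refl M Dset σ (toTorus M y') + Pi.single b 1) = u + Pi.single a 1 - Pi.single b 1 := by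
      rw [hu]; abel
    have e2 : toTorus M y + Pi.single a 1 - refl M Dset σ (toTorus M y') = u + Pi.single a 1 := by rw [hu]; abel
    have e3 : toTorus M y - (refl M Dset σ (toTorus M y') + Pi.single b 1) = u - Pi.single b 1 := by rw [hu]; abel
    rw [e1, e2, e3]
    ring

/-! ## The coordinates of the image points -/

omit [NeZero M] in
/-- The `κ`-coordinate of `ι y − σ·ι y'` is the class of the integer `y_κ − r` with `r ∈ {y'_κ, −y'_κ, −1 − y'_κ}`. -/
theorem sub_refl_apply (σ : Fin d → Bool) (y y' : Fin d → ℤ) (κ : Fin d) :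
    (toTorus M y - refl M Dset σ (toTorus M y')) κ =
      (((y κ - (if σ κ then (if κ ∈ Dset then -y' κ else -1 - y' κ) else y' κ) : ℤ)) : ZMod (2 * M)) := by
  simp only [toTorus, refl, Pi.sub_apply]
  split_ifs <;> push_cast <;> ring

/-- A lower bound for one centred coordinate bounds the torus distance from below. -/
theorem abs_valMinAbs_le_dist {L : ℕ} [NeZero L] (z : TorusSite d L) (κ : Fin d) :
    |(((z κ).valMinAbs : ℤ) : ℝ)| ≤ Real.sqrt (∑ k, (((z k).valMinAbs : ℤ) : ℝ) ^ 2) := by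
  rw [← Real.sqrt_sq_eq_abs]
  exact Real.sqrt_le_sqrt (Finset.single_le_sum (f := fun k => (((z k).valMinAbs : ℤ) : ℝ) ^ 2)
    (fun k _ => sq_nonneg _) (Finset.mem_univ κ))

/-! ## The estimate (T): `(1 + dist_∞)⁻⁴` decay of the mixed second differences of the box Green function (d = 4) -/

/-- **Estimate (T) for the D/N box Green function** (`d = 4`): there is an absolute constant `C` such that for every half-period
`M ≥ 1`, every set of Dirichlet directions, all directions `a, b, κ` and all box points `s, s'`,
`|Δ_a Δ'_b G_B(s, s')| · (1 + |s_κ − s'_κ|)⁴ ≤ C`, i.e. `|∇_a∇'_b G_B(s,s')| ≤ C (1 + |s − s'|_∞)^{−4}` uniformly in the box —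
sixteen torus Hessians at the images (each at torus distance `≥ |s_κ − s'_κ| − 1` in the coordinate `κ`), bounded by the all-points
Calderón–Zygmund estimate `torusGreen_hessian_le`. -/
theorem boxGreen_hessian_decay : ∃ C : ℝ, 0 ≤ C ∧ ∀ (M : ℕ) [NeZero M] (Dset : Finset (Fin 4)) (a b κ : Fin 4)
    (s s' : Box 4 M Dset),
    |boxGreen M Dset (coords s + Pi.single a 1) (coords s' + Pi.single b 1) - boxGreen M Dset (coords s + Pi.single a 1) (coords s') -
        boxGreen M Dset (coords s) (coords s' + Pi.single b 1) + boxGreen M Dset (coords s) (coords s')| *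
      (1 + |(((s.1 κ : ℕ) : ℝ)) - ((s'.1 κ : ℕ) : ℝ)|) ^ 4 ≤ C := by
  obtain ⟨C₁, hC₁0, hH⟩ := torusGreen_hessian_le
  refine ⟨648 * C₁, by positivity, ?_⟩
  intro M _ Dset a b κ s s'
  have hL : 2 ≤ 2 * M := by have := Nat.pos_of_ne_zero (NeZero.ne M); omega
  set y : Fin 4 → ℤ := coords s with hy
  set y' : Fin 4 → ℤ := coords s' with hy'
  set n : ℝ := |(((s.1 κ : ℕ) : ℝ)) - ((s'.1 κ : ℕ) : ℝ)| with hn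
  have hn0 : 0 ≤ n := abs_nonneg _
  have hnint : n = (( |y κ - y' κ| : ℤ) : ℝ) := by rw [hn, hy, hy']; simp [coords]
  -- bounds on the coordinates
  have hs0 : 0 ≤ y κ := by simp [hy, coords]
  have hsM : y κ < M := by simp only [hy, coords]; exact_mod_cast (s.1 κ).isLt
  have hs0' : 0 ≤ y' κ := by simp [hy', coords]
  have hsM' : y' κ < M := by simp only [hy', coords]; exact_mod_cast (s'.1 κ).isLt
  -- the per-image bound
  have hterm : ∀ (σ : Fin 4 → Bool), ∀ z : TorusSite 4 (2 * M), ∀ δ : ℤ, -1 ≤ δ → δ ≤ 1 →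
      z κ = (((y κ - (if σ κ then (if κ ∈ Dset then -y' κ else -1 - y' κ) else y' κ) + δ : ℤ)) : ZMod (2 * M)) →
      |torusGreen (z + Pi.single a 1) - torusGreen (z + Pi.single a 1 - Pi.single b 1) - torusGreen z +
          torusGreen (z - Pi.single b 1)| * (1 + n) ^ 4 ≤ 81 * C₁ := by
    intro σ z δ hδ0 hδ1 hz
    have hHz := hH (2 * M) hL a b z
    -- the coordinate κ of z is far from 0
    have hfar : (( |y κ - y' κ| : ℤ) : ℝ) - 1 ≤ Real.sqrt (∑ k, (((z k).valMinAbs : ℤ) : ℝ) ^ 2) := by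
      refine le_trans ?_ (abs_valMinAbs_le_dist z κ)
      rw [hz, ← Int.cast_one, ← Int.cast_sub, ← Int.cast_abs, Int.cast_le]
      refine le_abs_valMinAbs_of_forall (2 * M) _ _ fun j => ?_
      have hm : (y κ - (if σ κ then (if κ ∈ Dset then -y' κ else -1 - y' κ) else y' κ)) = y κ - y' κ ∨
          (y κ - (if σ κ then (if κ ∈ Dset then -y' κ else -1 - y' κ) else y' κ)) = y κ + y' κ ∨
          (y κ - (if σ κ then (if κ ∈ Dset then -y' κ else -1 - y' κ) else y' κ)) = y κ + y' κ + 1 := by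
        split_ifs
        · right; left; ring
        · right; right; ring
        · left; rfl
      exact repr_bound hs0 hsM hs0' hsM' hδ0 hδ1 hm j
    rw [← hnint] at hfar
    -- `1 + n ≤ 3 max(1, dist)`
    have hmax : 1 + n ≤ 3 * max 1 (Real.sqrt (∑ k, (((z k).valMinAbs : ℤ) : ℝ) ^ 2)) := by
      rcases le_or_gt 2 n with h2 | h2
      · calc 1 + n ≤ 3 * (n - 1) := by linarith
          _ ≤ 3 * max 1 (Real.sqrt (∑ k, (((z k).valMinAbs : ℤ) : ℝ) ^ 2)) :=
              mul_le_mul_of_nonneg_left (hfar.trans (le_max_right _ _)) (by norm_num)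
      · calc 1 + n ≤ 3 * 1 := by linarith
          _ ≤ 3 * max 1 (Real.sqrt (∑ k, (((z k).valMinAbs : ℤ) : ℝ) ^ 2)) :=
              mul_le_mul_of_nonneg_left (le_max_left _ _) (by norm_num)
    have hm0 : 0 ≤ max 1 (Real.sqrt (∑ k, (((z k).valMinAbs : ℤ) : ℝ) ^ 2)) := le_trans zero_le_one (le_max_left _ _)
    have hpow : (1 + n) ^ 4 ≤ 81 * (max 1 (Real.sqrt (∑ k, (((z k).valMinAbs : ℤ) : ℝ) ^ 2))) ^ 4 := by
      calc (1 + n) ^ 4 ≤ (3 * max 1 (Real.sqrt (∑ k, (((z k).valMinAbs : ℤ) : ℝ) ^ 2))) ^ 4 :=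
            pow_le_pow_left₀ (by linarith) hmax 4
        _ = 81 * (max 1 (Real.sqrt (∑ k, (((z k).valMinAbs : ℤ) : ℝ) ^ 2))) ^ 4 := by ring
    calc |torusGreen (z + Pi.single a 1) - torusGreen (z + Pi.single a 1 - Pi.single b 1) - torusGreen z +
            torusGreen (z - Pi.single b 1)| * (1 + n) ^ 4
          ≤ |torusGreen (z + Pi.single a 1) - torusGreen (z + Pi.single a 1 - Pi.single b 1) - torusGreen z +
            torusGreen (z - Pi.single b 1)| * (81 * (max 1 (Real.sqrt (∑ k, (((z k).valMinAbs : ℤ) : ℝ) ^ 2))) ^ 4) :=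
          mul_le_mul_of_nonneg_left hpow (abs_nonneg _)
      _ = 81 * (|torusGreen (z + Pi.single a 1) - torusGreen (z + Pi.single a 1 - Pi.single b 1) - torusGreen z +
            torusGreen (z - Pi.single b 1)| * (max 1 (Real.sqrt (∑ k, (((z k).valMinAbs : ℤ) : ℝ) ^ 2))) ^ 4) := by ring
      _ ≤ 81 * C₁ := mul_le_mul_of_nonneg_left hHz (by norm_num)
  -- sum over the sixteen images
  rw [boxGreen_hessian_eq]
  set T : (Fin 4 → Bool) → ℝ := fun σ =>
    if σ b then
      (torusGreen (toTorus M y - refl M Dset σ (toTorus M y') + Pi.single b 1 + Pi.single a 1) -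
        torusGreen (toTorus M y - refl M Dset σ (toTorus M y') + Pi.single b 1 + Pi.single a 1 - Pi.single b 1) -
        torusGreen (toTorus M y - refl M Dset σ (toTorus M y') + Pi.single b 1) +
        torusGreen (toTorus M y - refl M Dset σ (toTorus M y') + Pi.single b 1 - Pi.single b 1))
    else
      -(torusGreen (toTorus M y - refl M Dset σ (toTorus M y') + Pi.single a 1) -
        torusGreen (toTorus M y - refl M Dset σ (toTorus M y') + Pi.single a 1 - Pi.single b 1) -
        torusGreen (toTorus M y - refl M Dset σ (toTorus M y')) +
        torusGreen (toTorus M y - refl M Dset σ (toTorus M y') - Pi.single b 1)) with hT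
  have hTσ : ∀ σ : Fin 4 → Bool, |T σ| * (1 + n) ^ 4 ≤ 81 * C₁ := by
    intro σ
    set u : TorusSite 4 (2 * M) := toTorus M y - refl M Dset σ (toTorus M y') with hu
    by_cases hσ : σ b = true
    · simp only [hT, hσ, if_true]
      refine hterm σ (u + Pi.single b 1) (if κ = b then 1 else 0) (by split_ifs <;> norm_num) (by split_ifs <;> norm_num) ?_
      rw [Pi.add_apply, hu, sub_refl_apply]
      by_cases hκb : κ = b
      · subst hκb; simp
      · simp [hκb]
    · simp only [hT, hσ, Bool.false_eq_true, if_false, abs_neg]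
      refine hterm σ u 0 (by norm_num) zero_le_one ?_
      rw [hu, sub_refl_apply]; simp
  have h12 : (0 : ℝ) < 1 / 2 := by norm_num
  calc |(1 / 2 : ℝ) * ∑ σ : Fin 4 → Bool, sgn Dset σ * T σ| * (1 + n) ^ 4
        = (1 / 2 : ℝ) * (|∑ σ : Fin 4 → Bool, sgn Dset σ * T σ| * (1 + n) ^ 4) := by
        rw [abs_mul, abs_of_pos h12, mul_assoc]
    _ ≤ (1 / 2 : ℝ) * ((∑ σ : Fin 4 → Bool, |sgn Dset σ * T σ|) * (1 + n) ^ 4) :=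
        mul_le_mul_of_nonneg_left (mul_le_mul_of_nonneg_right (Finset.abs_sum_le_sum_abs _ _) (by positivity)) h12.le
    _ = (1 / 2 : ℝ) * ∑ σ : Fin 4 → Bool, |T σ| * (1 + n) ^ 4 := by
        rw [Finset.sum_mul]
        congr 1
        exact Finset.sum_congr rfl fun σ _ => by rw [abs_mul, abs_sgn, one_mul]
    _ ≤ (1 / 2 : ℝ) * ∑ σ : Fin 4 → Bool, (81 * C₁ : ℝ) :=
        mul_le_mul_of_nonneg_left (Finset.sum_le_sum fun σ _ => hTσ σ) h12.le
    _ = 648 * C₁ := by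
        rw [Finset.sum_const, Finset.card_univ, Fintype.card_fun, Fintype.card_bool, Fintype.card_fin, nsmul_eq_mul]
        push_cast
        ring

/-- **Estimate (T) for the inverse of the D/N box Laplacian** (`d = 4`, at least one Dirichlet direction): with the constant of
`boxGreen_hessian_decay`, for box points `s, t = s + e_a` and `s', t' = s' + e_b`,
`|L⁻¹(t,t') − L⁻¹(t,s') − L⁻¹(s,t') + L⁻¹(s,s')| · (1 + |s_κ − s'_κ|)⁴ ≤ C` for every coordinate `κ`. -/
theorem boxLap_inv_hessian_decay : ∃ C : ℝ, 0 ≤ C ∧ ∀ (M : ℕ) [NeZero M] (Dset : Finset (Fin 4)), Dset.Nonempty →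
    ∀ (a b κ : Fin 4) (s t s' t' : Box 4 M Dset), coords t = coords s + Pi.single a 1 → coords t' = coords s' + Pi.single b 1 →
    |(boxLap M Dset)⁻¹ t t' - (boxLap M Dset)⁻¹ t s' - (boxLap M Dset)⁻¹ s t' + (boxLap M Dset)⁻¹ s s'| *
      (1 + |(((s.1 κ : ℕ) : ℝ)) - ((s'.1 κ : ℕ) : ℝ)|) ^ 4 ≤ C := by
  obtain ⟨C, hC0, hC⟩ := boxGreen_hessian_decay
  refine ⟨C, hC0, ?_⟩
  intro M _ Dset hD a b κ s t s' t' ht ht'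
  rw [boxLap_inv_eq hD]
  simp only [boxGreenMat, Matrix.of_apply, ht, ht']
  exact hC M Dset a b κ s s'

end Summit.QuantumFields.YangMills.Theorems.AllWindowsColdBox.BoxKernel

end
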